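import Literature.NumberTheory.Rogawski1990.AdelicCartanClass
import HarnessLib

/-!
# The CONVERSE of the adelic Cartan class calculus: `x_{g′} = t⋆ x_g t` with `t ∈ Z(γ₀ ⊗ 1)` ⇒ the matching adèles are `U(H)(𝐀)`-conjugate;
# `x_g = t⋆ ((H⁻¹ H_{g₀}) ⊗ 1) t` ⇒ the matching adèle is RATIONAL over `δ = g₀ γ₀ g₀⁻¹`
(Rogawski, *Automorphic representations of unitary groups in three variables* (1990), §3.1 p. 19, §3.3 (3.3.1) and Prop. 3.3.1 p. 22; Kottwitz,
*Stable trace formula: elliptic singular terms* (1986), §9)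

Topic `NumberTheory/Rogawski1990`; namespace `Literature.NumberTheory.Rogawski1990`; THEOREMS ONLY (no definition, no instance, no named fact, no notation).
Cell `pub/hodgecm-mathlib`, ENGINE T1 (crux H413 = `stmt-HodgeConjecture-24833`), row G6, the «P1-𝔸» brick of the R6d∕R7 blueprint
(`BLUEPRINT-R6dR7-CartanObsHasse.F0P5a-p03g4`): ★ R6d-β `AdelicCartanClass` proves `p ∼ q` in `U(H)(𝐀)` ⇒ `x_{g′} = t⋆ x_g t` (`t ∈ Z(γ₀ ⊗ 1)`) and
`p` rational over `γ` ⇒ `x_g = t⋆ ((H⁻¹ H_{g₀}) ⊗ 1) t`; here the two converses, which is how R7's `cartanObsHasse` (→) ENDS: once the class of `p` is the image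
of a global class `y = H⁻¹ H_{g₀}` realised by a rational `δ = g₀ γ₀ g₀⁻¹ ∈ U(H)(L⁺)` (★ R6a), `p` is rational over `δ` — adelically, in one algebraic stroke
(★ R6a `exists_unitary_conj_of_inv_mul_twistGram_eq` at `R := 𝔸_L`: no place-by-place projection, no regularity, no integrality almost everywhere); in
particular the P5 assembly's `hloc` binder (P1) is a theorem (`MatchingAdeleG₂.forall_isConj_toLocal_and_isConj_arch_of_adelicCartan_eq`).

* §1 (any commutative ring `R`, `σ : R →+* R`, `H` with `IsUnit H.det`): the generic converse IS ★ R6a `exists_unitary_conj_of_inv_mul_twistGram_eq`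
  (`g γ g⁻¹ = δ`, `g′ γ g′⁻¹ = δ′`, `t γ = γ t`, `H⁻¹ H_{g′} = t⋆ (H⁻¹ H_g) t` ⇒ `u δ′ u⁻¹ = δ` for the unitary `u := g t g′⁻¹`); here only the `iff` for two
  ARBITRARY conjugators, `exists_unitary_conj_iff_exists_commute_inv_mul_twistGram_eq` (with ★ R1 `exists_commute_eq_mul_of_conj_eq`,
  ★ `twistGram_eq_of_unitary_conj`, ★ `inv_mul_twistGram_mul`).
* §2 (`R := 𝔸_L`, self carrier ★ `MatchingAdeleG₂ L H H γ₀`): **`MatchingAdeleG₂.isConjAdele_of_adelicCartan_eq`** and the `iff`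
  `MatchingAdeleG₂.isConjAdele_iff_exists_commute_adelicCartan_eq` (with ★ `exists_commute_adelicCartan_eq_of_isConjAdele`);
  **`MatchingAdeleG₂.isRationalOver_of_adelicCartan_eq_map`** and the `iff` `MatchingAdeleG₂.isRationalOver_iff_exists_commute_adelicCartan_eq_map`
  (with ★ `exists_commute_adelicCartan_eq_map_of_isRationalOver`) — Prop. 3.3.1 read as: `p` is rational over `δ = g₀ γ₀ g₀⁻¹` iff its adelic Cartan class is
  the image of the GLOBAL class `H⁻¹ H_{g₀}` modulo adelic norms.

## References
* [Rogawski1990] J. D. Rogawski, *Automorphic Representations of Unitary Groups in Three Variables*, Ann. of Math. Stud. 123 (1990), §3.1 p. 19, §3.3 (3.3.1),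
  Prop. 3.3.1 p. 22, §5.4 p. 72.
* [Kottwitz1986] R. E. Kottwitz, *Stable trace formula: elliptic singular terms*, Math. Ann. 275 (1986), §9.
-/

set_option autoImplicit false

noncomputable section

open NumberField
open scoped Matrix

namespace Literature.NumberTheory.Rogawski1990

open Literature.NumberTheory.Automorphic
open Literature.AlgebraicGeometry.ShimuraVarieties (unitaryGroup)

/-! ## §1 Over any commutative ring: the unitary conjugator `u := g′ (g t)⁻¹` -/

section Generic

variable {R : Type*} [CommRing R] {n : Type*} [Fintype n] [DecidableEq n] (σ : R →+* R) (H : Matrix n n R)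

/-- **The criterion for two ARBITRARY conjugators** (`iff` form): for `g γ g⁻¹ = p`, `g′ γ g′⁻¹ = q` (`γ, p, q` arbitrary in `GL_n(R)`), `p` and `q` are conjugate in
`U_σ(H)(R)` iff `H⁻¹ H_{g′} = t⋆ (H⁻¹ H_g) t` for some `t ∈ Z_{GL_n(R)}(γ)` — (→) ★ `exists_commute_eq_mul_of_conj_eq` + ★ `twistGram_eq_of_unitary_conj` +
★ `inv_mul_twistGram_mul`; (←) ★ R6a `exists_unitary_conj_of_inv_mul_twistGram_eq` (the unitary `g t g′⁻¹` conjugates `q` to `p`). [cite: Rogawski1990, §3.1 p. 19; §3.3 (3.3.1) p. 22] -/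
theorem exists_unitary_conj_iff_exists_commute_inv_mul_twistGram_eq (hH : IsUnit H.det) {γ p q g g' : GL n R} (hg : g * γ * g⁻¹ = p)
    (hg' : g' * γ * g'⁻¹ = q) :
    (∃ u : GL n R, u ∈ unitaryGroup σ H ∧ u * p * u⁻¹ = q) ↔
      ∃ t : GL n R, t * γ = γ * t ∧
        H⁻¹ * twistGram σ H (g' : Matrix n n R) = hermStar σ H (t : Matrix n n R) * (H⁻¹ * twistGram σ H (g : Matrix n n R)) * (t : Matrix n n R) := by
  constructor
  · rintro ⟨u, hu, huconj⟩
    -- `u g` conjugates `γ` to `q` with `H_{u g} = H_g`; compare with `g′`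
    obtain ⟨hug, hx⟩ := twistGram_eq_of_unitary_conj σ H hu hg
    rw [huconj] at hug
    obtain ⟨t, ht, rfl⟩ := exists_commute_eq_mul_of_conj_eq hug hg'
    refine ⟨t, ht, ?_⟩
    rw [Units.val_mul, inv_mul_twistGram_mul σ H hH, hx]
  · rintro ⟨t, ht, hx⟩
    obtain ⟨u, hu, huconj⟩ := exists_unitary_conj_of_inv_mul_twistGram_eq σ H hH hg hg' ht hx
    -- `u q u⁻¹ = p`; invert
    refine ⟨u⁻¹, inv_mem hu, ?_⟩
    rw [← huconj, inv_inv]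
    simp only [mul_assoc, inv_mul_cancel_left, inv_mul_cancel, mul_one]

end Generic

/-! ## §2 On the self carrier `𝒞′_𝐀(γ₀) ⊂ U(H)(𝐀)` (`R := 𝔸_L`, `σ := c ⊗ 1`, form `H ⊗ 1`) -/

section Self

variable {L : Type} [Field L] [NumberField L] [IsCMField L] {H : Matrix (Fin 3) (Fin 3) L} {γ₀ : (UnitaryGroup.cmDatum L 3 H).Rational}

/-- **`x_{g′} = t⋆ x_g t` with `t ∈ Z(γ₀ ⊗ 1)` ⇒ `p ∼ q` in `U(H)(𝐀)`** (the converse of ★ `exists_commute_adelicCartan_eq_of_isConjAdele`): for matching adèles `p, q`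
over `γ₀` with adelic conjugators `g` of `p`, `g′` of `q` (`g (γ₀ ⊗ 1) g⁻¹ = p`, …), `t ∈ GL₃(𝔸_L)` commuting with `γ₀ ⊗ 1` and
`(H ⊗ 1)⁻¹ (H ⊗ 1)_{g′} = t⋆ · (H ⊗ 1)⁻¹ (H ⊗ 1)_g · t`, the unitary `u := g t g′⁻¹ ∈ U(H)(𝐀)` conjugates `q` to `p` (★ R6a `exists_unitary_conj_of_inv_mul_twistGram_eq`
at `R := 𝔸_L`; `U(H)(𝐀)` IS ★ `unitaryGroup (adeleConj L) (H ⊗ 1)`). [cite: Rogawski1990, §3.3 (3.3.1) p. 22; §5.4 p. 72] [cite: Kottwitz1986, §9] -/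
theorem MatchingAdeleG₂.isConjAdele_of_adelicCartan_eq (hH : IsUnit H.det) {p q : MatchingAdeleG₂ L H H γ₀} {g g' t : GL (Fin 3) (AdeleRing (𝓞 L) L)}
    (hg : g * (((UnitaryGroup.cmDatum L 3 H).toAdelic γ₀).val : GL (Fin 3) (AdeleRing (𝓞 L) L)) * g⁻¹ = (p.adele.val : GL (Fin 3) (AdeleRing (𝓞 L) L)))
    (hg' : g' * (((UnitaryGroup.cmDatum L 3 H).toAdelic γ₀).val : GL (Fin 3) (AdeleRing (𝓞 L) L)) * g'⁻¹ = (q.adele.val : GL (Fin 3) (AdeleRing (𝓞 L) L)))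
    (ht : t * (((UnitaryGroup.cmDatum L 3 H).toAdelic γ₀).val : GL (Fin 3) (AdeleRing (𝓞 L) L)) =
      (((UnitaryGroup.cmDatum L 3 H).toAdelic γ₀).val : GL (Fin 3) (AdeleRing (𝓞 L) L)) * t)
    (hx : (H.map (algebraMap L (AdeleRing (𝓞 L) L)))⁻¹ * twistGram (adeleConj L) (H.map (algebraMap L (AdeleRing (𝓞 L) L))) (g' : Matrix (Fin 3) (Fin 3) (AdeleRing (𝓞 L) L)) =
      hermStar (adeleConj L) (H.map (algebraMap L (AdeleRing (𝓞 L) L))) (t : Matrix (Fin 3) (Fin 3) (AdeleRing (𝓞 L) L)) *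
        ((H.map (algebraMap L (AdeleRing (𝓞 L) L)))⁻¹ * twistGram (adeleConj L) (H.map (algebraMap L (AdeleRing (𝓞 L) L))) (g : Matrix (Fin 3) (Fin 3) (AdeleRing (𝓞 L) L))) *
        (t : Matrix (Fin 3) (Fin 3) (AdeleRing (𝓞 L) L))) :
    p.IsConjAdele q := by
  obtain ⟨u, hu, huconj⟩ := exists_unitary_conj_of_inv_mul_twistGram_eq (adeleConj L) (H.map (algebraMap L (AdeleRing (𝓞 L) L)))
    (isUnit_det_adelicForm hH) hg hg' ht hx
  exact (isConj_iff.mpr ⟨⟨u, hu⟩, Subtype.ext huconj⟩ : q.IsConjAdele p).symm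

/-- **`p ∼ q` in `U(H)(𝐀)` iff `x_{g′} = t⋆ x_g t` for some `t ∈ Z(γ₀ ⊗ 1)`** (any fixed adelic conjugators `g` of `p`, `g′` of `q`): ★ `exists_commute_adelicCartan_eq_of_isConjAdele`
and `MatchingAdeleG₂.isConjAdele_of_adelicCartan_eq` — the adelic Cartan class modulo norms SEPARATES the `U(H)(𝐀)`-classes inside `𝒞′_𝐀(γ₀)`.
[cite: Rogawski1990, §3.3 (3.3.1) p. 22; §5.4 p. 72] [cite: Kottwitz1986, §9] -/
theorem MatchingAdeleG₂.isConjAdele_iff_exists_commute_adelicCartan_eq (hH : IsUnit H.det) {p q : MatchingAdeleG₂ L H H γ₀} {g g' : GL (Fin 3) (AdeleRing (𝓞 L) L)}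
    (hg : g * (((UnitaryGroup.cmDatum L 3 H).toAdelic γ₀).val : GL (Fin 3) (AdeleRing (𝓞 L) L)) * g⁻¹ = (p.adele.val : GL (Fin 3) (AdeleRing (𝓞 L) L)))
    (hg' : g' * (((UnitaryGroup.cmDatum L 3 H).toAdelic γ₀).val : GL (Fin 3) (AdeleRing (𝓞 L) L)) * g'⁻¹ = (q.adele.val : GL (Fin 3) (AdeleRing (𝓞 L) L))) :
    p.IsConjAdele q ↔
      ∃ t : GL (Fin 3) (AdeleRing (𝓞 L) L),
        t * (((UnitaryGroup.cmDatum L 3 H).toAdelic γ₀).val : GL (Fin 3) (AdeleRing (𝓞 L) L)) =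
            (((UnitaryGroup.cmDatum L 3 H).toAdelic γ₀).val : GL (Fin 3) (AdeleRing (𝓞 L) L)) * t ∧
          (H.map (algebraMap L (AdeleRing (𝓞 L) L)))⁻¹ * twistGram (adeleConj L) (H.map (algebraMap L (AdeleRing (𝓞 L) L))) (g' : Matrix (Fin 3) (Fin 3) (AdeleRing (𝓞 L) L)) =
            hermStar (adeleConj L) (H.map (algebraMap L (AdeleRing (𝓞 L) L))) (t : Matrix (Fin 3) (Fin 3) (AdeleRing (𝓞 L) L)) *
              ((H.map (algebraMap L (AdeleRing (𝓞 L) L)))⁻¹ * twistGram (adeleConj L) (H.map (algebraMap L (AdeleRing (𝓞 L) L))) (g : Matrix (Fin 3) (Fin 3) (AdeleRing (𝓞 L) L))) *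
              (t : Matrix (Fin 3) (Fin 3) (AdeleRing (𝓞 L) L)) :=
  ⟨fun h => exists_commute_adelicCartan_eq_of_isConjAdele hH h hg hg', fun ⟨_, ht, hx⟩ => MatchingAdeleG₂.isConjAdele_of_adelicCartan_eq hH hg hg' ht hx⟩

/-- **THE `hloc` STEP (P1) OF ★-TO-BE `cartanObsHasse_of_steps`, DISCHARGED ADELICALLY**: norm-equivalent adelic classes — `x_g = t⋆ x_{g′} t` with `t ∈ Z(γ₀ ⊗ 1)`, for
adelic conjugators `g` of `p` and `g′` of `q` — force `q ∼ p` in `U(H)(𝐀)` (`MatchingAdeleG₂.isConjAdele_of_adelicCartan_eq`), hence `q_v ∼ p_v` in `U(H)(L⁺_v)` for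
every finite `v` (★ `IsConjAdele.toLocal`) and `q_∞ ∼ p_∞` in `U(H)(L ⊗ ℝ)` (★ `IsConjAdele.arch`).  Stated in the binder shape of the blueprint's P5 assembly.
[cite: Rogawski1990, §3.3 (3.3.1) p. 22; §5.4 p. 72] [cite: Kottwitz1986, §9] -/
theorem MatchingAdeleG₂.forall_isConj_toLocal_and_isConj_arch_of_adelicCartan_eq (hH : IsUnit H.det) (p q : MatchingAdeleG₂ L H H γ₀)
    (g g' t : GL (Fin 3) (AdeleRing (𝓞 L) L))
    (hg : g * (((UnitaryGroup.cmDatum L 3 H).toAdelic γ₀).val : GL (Fin 3) (AdeleRing (𝓞 L) L)) * g⁻¹ = (p.adele.val : GL (Fin 3) (AdeleRing (𝓞 L) L)))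
    (hg' : g' * (((UnitaryGroup.cmDatum L 3 H).toAdelic γ₀).val : GL (Fin 3) (AdeleRing (𝓞 L) L)) * g'⁻¹ = (q.adele.val : GL (Fin 3) (AdeleRing (𝓞 L) L)))
    (ht : t * (((UnitaryGroup.cmDatum L 3 H).toAdelic γ₀).val : GL (Fin 3) (AdeleRing (𝓞 L) L)) =
      (((UnitaryGroup.cmDatum L 3 H).toAdelic γ₀).val : GL (Fin 3) (AdeleRing (𝓞 L) L)) * t)
    (hx : (H.map (algebraMap L (AdeleRing (𝓞 L) L)))⁻¹ * twistGram (adeleConj L) (H.map (algebraMap L (AdeleRing (𝓞 L) L))) (g : Matrix (Fin 3) (Fin 3) (AdeleRing (𝓞 L) L)) =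
      hermStar (adeleConj L) (H.map (algebraMap L (AdeleRing (𝓞 L) L))) (t : Matrix (Fin 3) (Fin 3) (AdeleRing (𝓞 L) L)) *
        ((H.map (algebraMap L (AdeleRing (𝓞 L) L)))⁻¹ * twistGram (adeleConj L) (H.map (algebraMap L (AdeleRing (𝓞 L) L))) (g' : Matrix (Fin 3) (Fin 3) (AdeleRing (𝓞 L) L))) *
        (t : Matrix (Fin 3) (Fin 3) (AdeleRing (𝓞 L) L))) :
    (∀ v : IsDedekindDomain.HeightOneSpectrum (𝓞 ↥(maximalRealSubfield L)),
        IsConj ((UnitaryGroup.cmDatum L 3 H).toLocal v q.adele) ((UnitaryGroup.cmDatum L 3 H).toLocal v p.adele)) ∧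
      IsConj q.arch p.arch :=
  have h : q.IsConjAdele p := MatchingAdeleG₂.isConjAdele_of_adelicCartan_eq hH hg' hg ht hx
  ⟨fun v => h.toLocal v, h.arch⟩

/-- **`x_g = t⋆ ((H⁻¹ H_{g₀}) ⊗ 1) t` ⇒ `p` IS RATIONAL OVER `δ = g₀ γ₀ g₀⁻¹`** (the converse of ★ `exists_commute_adelicCartan_eq_map_of_isRationalOver`; Prop. 3.3.1 (→),
final step): for a matching adèle `p` over `γ₀` with adelic conjugator `g`, a rational `δ ∈ U(H)(L⁺)` with `g₀ γ₀ g₀⁻¹ = δ` in `GL₃(L)`, and `t ∈ Z(γ₀ ⊗ 1)` with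
`(H ⊗ 1)⁻¹ (H ⊗ 1)_g = t⋆ · ((H⁻¹ H_{g₀}) ⊗ 1) · t`, the unitary `u := (g₀ ⊗ 1) t g⁻¹ ∈ U(H)(𝐀)` conjugates `p` to `δ ⊗ 1` (★ R6a
`exists_unitary_conj_of_inv_mul_twistGram_eq` at `R := 𝔸_L`) — `(H⁻¹ H_{g₀}) ⊗ 1 = (H ⊗ 1)⁻¹ (H ⊗ 1)_{g₀ ⊗ 1}` (★ `twistGram_map_adele`, ★ `map_nonsing_inv_of_isUnit`)
and `g₀ ⊗ 1` conjugates `γ₀ ⊗ 1` to `δ ⊗ 1`. [cite: Rogawski1990, §3.3 Prop. 3.3.1 p. 22; §5.4 p. 72] [cite: Kottwitz1986, §9] -/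
theorem MatchingAdeleG₂.isRationalOver_of_adelicCartan_eq_map (hH : IsUnit H.det) {p : MatchingAdeleG₂ L H H γ₀} {δ : (UnitaryGroup.cmDatum L 3 H).Rational}
    {g₀ : GL (Fin 3) L} (hg₀ : g₀ * ((γ₀ : unitaryGroup (cmConjRingHom L) H).val : GL (Fin 3) L) * g₀⁻¹ = ((δ : unitaryGroup (cmConjRingHom L) H).val : GL (Fin 3) L))
    {g t : GL (Fin 3) (AdeleRing (𝓞 L) L)}
    (hg : g * (((UnitaryGroup.cmDatum L 3 H).toAdelic γ₀).val : GL (Fin 3) (AdeleRing (𝓞 L) L)) * g⁻¹ = (p.adele.val : GL (Fin 3) (AdeleRing (𝓞 L) L)))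
    (ht : t * (((UnitaryGroup.cmDatum L 3 H).toAdelic γ₀).val : GL (Fin 3) (AdeleRing (𝓞 L) L)) =
      (((UnitaryGroup.cmDatum L 3 H).toAdelic γ₀).val : GL (Fin 3) (AdeleRing (𝓞 L) L)) * t)
    (hx : (H.map (algebraMap L (AdeleRing (𝓞 L) L)))⁻¹ * twistGram (adeleConj L) (H.map (algebraMap L (AdeleRing (𝓞 L) L))) (g : Matrix (Fin 3) (Fin 3) (AdeleRing (𝓞 L) L)) =
      hermStar (adeleConj L) (H.map (algebraMap L (AdeleRing (𝓞 L) L))) (t : Matrix (Fin 3) (Fin 3) (AdeleRing (𝓞 L) L)) *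
        (H⁻¹ * twistGram (cmConjRingHom L) H (g₀ : Matrix (Fin 3) (Fin 3) L)).map (algebraMap L (AdeleRing (𝓞 L) L)) *
        (t : Matrix (Fin 3) (Fin 3) (AdeleRing (𝓞 L) L))) :
    p.IsRationalOver δ := by
  -- `g₀ ⊗ 1` conjugates `γ₀ ⊗ 1` to `δ ⊗ 1`, with class `(H⁻¹ H_{g₀}) ⊗ 1`
  have h₀ : toAdeleGL L g₀ * (((UnitaryGroup.cmDatum L 3 H).toAdelic γ₀).val : GL (Fin 3) (AdeleRing (𝓞 L) L)) * (toAdeleGL L g₀)⁻¹ =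
      (((UnitaryGroup.cmDatum L 3 H).toAdelic δ).val : GL (Fin 3) (AdeleRing (𝓞 L) L)) := by
    rw [UnitaryGroup.coe_cmDatum_toAdelic, UnitaryGroup.coe_cmDatum_toAdelic, ← map_inv, ← map_mul, ← map_mul, hg₀]
  have hx' : (H.map (algebraMap L (AdeleRing (𝓞 L) L)))⁻¹ * twistGram (adeleConj L) (H.map (algebraMap L (AdeleRing (𝓞 L) L))) (g : Matrix (Fin 3) (Fin 3) (AdeleRing (𝓞 L) L)) =
      hermStar (adeleConj L) (H.map (algebraMap L (AdeleRing (𝓞 L) L))) (t : Matrix (Fin 3) (Fin 3) (AdeleRing (𝓞 L) L)) *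
        ((H.map (algebraMap L (AdeleRing (𝓞 L) L)))⁻¹ * twistGram (adeleConj L) (H.map (algebraMap L (AdeleRing (𝓞 L) L)))
          ((toAdeleGL L g₀ : GL (Fin 3) (AdeleRing (𝓞 L) L)) : Matrix (Fin 3) (Fin 3) (AdeleRing (𝓞 L) L))) *
        (t : Matrix (Fin 3) (Fin 3) (AdeleRing (𝓞 L) L)) := by
    rw [hx, Matrix.map_mul, twistGram_map_adele, Literature.LinearAlgebra.Matrix.map_nonsing_inv_of_isUnit _ hH, val_toAdeleGL]
  obtain ⟨u, hu, huconj⟩ := exists_unitary_conj_of_inv_mul_twistGram_eq (adeleConj L) (H.map (algebraMap L (AdeleRing (𝓞 L) L)))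
    (isUnit_det_adelicForm hH) h₀ hg ht hx'
  exact (isConj_iff.mpr ⟨⟨u, hu⟩, Subtype.ext huconj⟩ : IsConj p.adele ((UnitaryGroup.cmDatum L 3 H).toAdelic δ)).symm

/-- **Prop. 3.3.1 as an `iff` on the self carrier**: for `δ = g₀ γ₀ g₀⁻¹ ∈ U(H)(L⁺)` and any adelic conjugator `g` of `p`, `p` is rational over `δ` iff
`x_g = t⋆ · ((H⁻¹ H_{g₀}) ⊗ 1) · t` for some `t ∈ Z(γ₀ ⊗ 1)` — the adelic class of `p` is the image of the GLOBAL class `H⁻¹ H_{g₀}` modulo adelic norms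
(★ `exists_commute_adelicCartan_eq_map_of_isRationalOver` and `MatchingAdeleG₂.isRationalOver_of_adelicCartan_eq_map`). [cite: Rogawski1990, §3.3 Prop. 3.3.1 p. 22] [cite: Kottwitz1986, §9] -/
theorem MatchingAdeleG₂.isRationalOver_iff_exists_commute_adelicCartan_eq_map (hH : IsUnit H.det) {p : MatchingAdeleG₂ L H H γ₀}
    {δ : (UnitaryGroup.cmDatum L 3 H).Rational} {g₀ : GL (Fin 3) L}
    (hg₀ : g₀ * ((γ₀ : unitaryGroup (cmConjRingHom L) H).val : GL (Fin 3) L) * g₀⁻¹ = ((δ : unitaryGroup (cmConjRingHom L) H).val : GL (Fin 3) L))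
    {g : GL (Fin 3) (AdeleRing (𝓞 L) L)}
    (hg : g * (((UnitaryGroup.cmDatum L 3 H).toAdelic γ₀).val : GL (Fin 3) (AdeleRing (𝓞 L) L)) * g⁻¹ = (p.adele.val : GL (Fin 3) (AdeleRing (𝓞 L) L))) :
    p.IsRationalOver δ ↔
      ∃ t : GL (Fin 3) (AdeleRing (𝓞 L) L),
        t * (((UnitaryGroup.cmDatum L 3 H).toAdelic γ₀).val : GL (Fin 3) (AdeleRing (𝓞 L) L)) =
            (((UnitaryGroup.cmDatum L 3 H).toAdelic γ₀).val : GL (Fin 3) (AdeleRing (𝓞 L) L)) * t ∧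
          (H.map (algebraMap L (AdeleRing (𝓞 L) L)))⁻¹ * twistGram (adeleConj L) (H.map (algebraMap L (AdeleRing (𝓞 L) L))) (g : Matrix (Fin 3) (Fin 3) (AdeleRing (𝓞 L) L)) =
            hermStar (adeleConj L) (H.map (algebraMap L (AdeleRing (𝓞 L) L))) (t : Matrix (Fin 3) (Fin 3) (AdeleRing (𝓞 L) L)) *
              (H⁻¹ * twistGram (cmConjRingHom L) H (g₀ : Matrix (Fin 3) (Fin 3) L)).map (algebraMap L (AdeleRing (𝓞 L) L)) *
              (t : Matrix (Fin 3) (Fin 3) (AdeleRing (𝓞 L) L)) :=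
  ⟨fun h => exists_commute_adelicCartan_eq_map_of_isRationalOver hH h hg₀ hg,
    fun ⟨_, ht, hx⟩ => MatchingAdeleG₂.isRationalOver_of_adelicCartan_eq_map hH hg₀ hg ht hx⟩

/-- **Corollary for R7 (→) in the shape ★ R6a delivers**: if the class of `p` is the image of a global class `y` — `x_g = t⋆ (y ⊗ 1) t`, `t ∈ Z(γ₀ ⊗ 1)` — and `y` is
REALISED by a rational element, `y = H⁻¹ H_{g₀}` with `δ = g₀ γ₀ g₀⁻¹ ∈ U(H)(L⁺)` (★ `exists_unitary_conj_inv_mul_twistGram_eq_of_invariants`), then `p` is rational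
over `δ`. [cite: Rogawski1990, §3.3 Prop. 3.3.1 p. 22] -/
theorem MatchingAdeleG₂.isRationalOver_of_adelicCartan_eq_map_of_eq (hH : IsUnit H.det) {p : MatchingAdeleG₂ L H H γ₀} {δ : (UnitaryGroup.cmDatum L 3 H).Rational}
    {g₀ : GL (Fin 3) L} (hg₀ : g₀ * ((γ₀ : unitaryGroup (cmConjRingHom L) H).val : GL (Fin 3) L) * g₀⁻¹ = ((δ : unitaryGroup (cmConjRingHom L) H).val : GL (Fin 3) L))
    {y : Matrix (Fin 3) (Fin 3) L} (hy : H⁻¹ * twistGram (cmConjRingHom L) H (g₀ : Matrix (Fin 3) (Fin 3) L) = y)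
    {g t : GL (Fin 3) (AdeleRing (𝓞 L) L)}
    (hg : g * (((UnitaryGroup.cmDatum L 3 H).toAdelic γ₀).val : GL (Fin 3) (AdeleRing (𝓞 L) L)) * g⁻¹ = (p.adele.val : GL (Fin 3) (AdeleRing (𝓞 L) L)))
    (ht : t * (((UnitaryGroup.cmDatum L 3 H).toAdelic γ₀).val : GL (Fin 3) (AdeleRing (𝓞 L) L)) =
      (((UnitaryGroup.cmDatum L 3 H).toAdelic γ₀).val : GL (Fin 3) (AdeleRing (𝓞 L) L)) * t)
    (hx : (H.map (algebraMap L (AdeleRing (𝓞 L) L)))⁻¹ * twistGram (adeleConj L) (H.map (algebraMap L (AdeleRing (𝓞 L) L))) (g : Matrix (Fin 3) (Fin 3) (AdeleRing (𝓞 L) L)) =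
      hermStar (adeleConj L) (H.map (algebraMap L (AdeleRing (𝓞 L) L))) (t : Matrix (Fin 3) (Fin 3) (AdeleRing (𝓞 L) L)) *
        y.map (algebraMap L (AdeleRing (𝓞 L) L)) * (t : Matrix (Fin 3) (Fin 3) (AdeleRing (𝓞 L) L))) :
    p.IsRationalOver δ := by
  subst hy
  exact MatchingAdeleG₂.isRationalOver_of_adelicCartan_eq_map hH hg₀ hg ht hx

end Self

end Literature.NumberTheory.Rogawski1990

end
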